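import Summits.HodgeConjecture.HodgeConjecture.Theorems.Ring2AbelianAllAndreBaseChangePencilsNodes
import Summits.HodgeConjecture.HodgeConjecture.Theorems.Ring2AbelianAllAndreIsogenousPencilsRank
import HarnessLib

/-!
# Ring 2 · sub-cell AbelianAll (ALL ABELIAN VARIETIES), André axis, part XXXV-g — FINITE ÉTALE BASE CHANGE, THE RANK FORM: along
# a connected finite étale base change `g : S' ⟶ S` of a compact pencil of abelian varieties the four ranks of parts XXX-d / XXXI-c
# (`dim N^p(fibre)`, `dim Im j^*`, `dim N^p_inv`, `r_p = dim j^* N^p(total)`) can only GROW from `(f, g t')` to `(f', t')`, the first is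
# unchanged, and when the cover creates NO NEW INVARIANT CLASSES at `t'` all four are EQUAL — hence so is the LIFT DEFECT
# `δ_p(f', t') = δ_p(f, g t')`. FACT-FREE

HONEST FRAMING (page 1, verbatim): **research route, not a corollary; conditional on HC_CM plus one named
minimal statement.** Cell line: research route conditional on HC_CM; not a corollary; Q11.4-sentence-2 already
refuted in dim ≥ 3. Nothing in this file proves a case of the Hodge conjecture for an abelian variety; `HC_CM`, `HC_AV`
do not occur; no node is born (0 `def`), no named fact is used, no `sorry`; axioms standard; nothing is claimed minimal.

## What this part does (the quantitative companion of parts XXXV-c/d, as XXXIV-d was for XXXIII-e/XXXIV-a)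

Notation: `f' = 𝒳 ×_S S' ⟶ S'` the pulled-back pencil, `G : 𝒳 ×_S S' ⟶ 𝒳`, `t = g(t')`, `e : (𝒳 ×_S S')_{t'} ≅ X_t` the fibre
identification (`e^* ∘ j_t^* = j'^*_{t'} ∘ G^*`), `N^p_inv(X_t) = N^p(X_t) ∩ Im j_t^*`, `r_p(f)(t) = dim j_t^* N^p(𝒳)`, lift defect
`δ_p(f, t) = dim N^p_inv(X_t) − r_p(f)(t)` (part XXX-d: `(L)_t(p) ⟺ δ_p(f, t) = 0`).

* §1 `map_fiberι_comp_fst_eq` (the identity `e^* ∘ j_t^* = j'^*_{t'} ∘ G^*` on the carriers), `algebraicClasses_fiber_baseChange_eq`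
  (`N^p((𝒳 ×_S S')_{t'}) = e^* N^p(X_t)`), `finrank_algebraicClasses_fiber_baseChange_eq` (SAME number of algebraic classes on the fibre).
* §2 MONOTONICITY (always): `finrank_range_fiberι_le_baseChange` (`dim Im j^*_t ≤ dim Im j'^*_{t'}`),
  `finrank_inf_range_le_baseChange` (`dim N^p_inv(X_t) ≤ dim N^p_inv(X'_{t'})`), `finrank_map_algebraicClasses_le_baseChange`
  (`r_p(f)(t) ≤ r_p(f')(t')`, `G^*` preserves algebraic classes: `G` is finite).
* §3 EQUALITY UNDER NO NEW INVARIANTS (`hinv` of part XXXV-d §3, at `t'`): `range_fiberι_baseChange_eq_of_forall_exists`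
  (`Im j'^*_{t'} = e^* Im j^*_t`), `finrank_range_fiberι_baseChange_eq_of_forall_exists`, `finrank_inf_range_baseChange_eq_of_forall_exists`
  (`dim N^p_inv` equal), **`map_algebraicClasses_baseChange_eq_of_forall_exists`** (`j'^*_{t'} N^p(𝒳 ×_S S') = e^* j_t^* N^p(𝒳)`: for
  `η'` algebraic upstairs, `η' ≡ G^* W` on every fibre, `G_* η'` is algebraic downstairs and `j_t^* G_* η' = c · j_t^* W`, `c ≠ 0`, by the
  ENGINE of part XXXV-c and the degree trick), `finrank_map_algebraicClasses_baseChange_eq_of_forall_exists` (`r_p` equal),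
  **`liftDefect_baseChange_eq_of_forall_exists`** (`δ_p(f', t') = δ_p(f, g t')`, additively).

What is NOT claimed: equality of `dim Im j^*`, `dim N^p_inv`, `r_p` WITHOUT `hinv` (a cover killing finite monodromy raises the first
two and may raise the third); any bound on `δ_p(f', t') − δ_p(f, t)` without `hinv` (both terms of the defect grow); anything minimal; any
case of HC; any node-level statement. EDGE LABELS: every row K (kernel, fact-free).

References: Andre1996Motifs (§5.3 p. 30 «remplacer S par un revêtement fini étale»); Abdulali1994FamiliesAV ((1.1) p. 1122); DeligneHodgeII1971
(Thm. 4.1.1, Cor. 4.2.8); VoisinHodgeI2002 (§7.3.2 Remark 7.29); VoisinHodgeII2003 (§4.3.1 Thm. 4.18); Fulton1998 (§1.7, §19.2);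
FultonYoungTableaux1997 (App. B §B.1 (5)–(7)); Kleiman1968AlgebraicCycles (§1.2); SGA1 (XII Prop. 2.4).
-/

noncomputable section

set_option linter.dupNamespace false

namespace Summit.HodgeConjecture.HodgeConjecture.Ring2.AbelianAll

open CategoryTheory CategoryTheory.Limits AlgebraicGeometry MonoidalCategory CartesianMonoidalCategory
open Literature.AlgebraicGeometry Literature.AlgebraicGeometry.Motives
open Literature.AlgebraicGeometry.HodgeTheory
open Summit.HodgeConjecture.HodgeConjecture.Theorems (isCompactAbelianPencil_familyPullback_snd)

variable {𝒳 S S' : SchemeOver ℂ} {d : ℕ} {f : 𝒳 ⟶ S}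

section BaseChange

variable (hf : IsCompactAbelianPencil f d) (g : S' ⟶ S) [IsFinite g.left] [Etale g.left] [ConnectedSpace (ComplexPoints S')]

/-! ## §1 The fibre identification on the carriers; algebraic classes of the fibre -/

omit [IsFinite g.left] [Etale g.left] [ConnectedSpace (ComplexPoints S')] in
/-- **`e^* ∘ j_t^* = j'^*_{t'} ∘ G^*`** for the fibre identification `e : (𝒳 ×_S S')_{t'} ≅ X_{g(t')}` (`fiberOverFamilyPullbackIso_hom_fiberι`).
[cite: Hartshorne1977, II §3 (base extension)] -/
theorem map_fiberι_comp_fst_eq (k : ℕ) (t' : ComplexPoints S') (W : complexBetti 𝒳 k) :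
    complexBetti.map (fiberι (familyPullback.snd f g) t') k (complexBetti.map (familyPullback.fst f g) k W) =
      complexBetti.map (fiberOverFamilyPullbackIso f g t').hom k (complexBetti.map (fiberι f (AlgPoints.map g t')) k W) := by
  rw [← complexBetti.map_comp_apply', ← fiberOverFamilyPullbackIso_hom_fiberι, complexBetti.map_comp_apply']

omit [IsFinite g.left] [Etale g.left] [ConnectedSpace (ComplexPoints S')] in
/-- **`N^p((𝒳 ×_S S')_{t'}) = e^* N^p(X_{g(t')})`**: the fibres upstairs ARE the fibres downstairs. [cite: GrothendieckTopology1969, §1] -/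
theorem algebraicClasses_fiber_baseChange_eq (p : ℕ) (t' : ComplexPoints S') :
    algebraicClasses (fiberOver (familyPullback.snd f g) t') p =
      (algebraicClasses (fiberOver f (AlgPoints.map g t')) p).map (complexBetti.map (fiberOverFamilyPullbackIso f g t').hom (2 * p)).hom := by
  set e := fiberOverFamilyPullbackIso f g t' with he
  refine le_antisymm (fun c' hc' ↦ ?_) ?_
  · refine ⟨complexBetti.map e.inv (2 * p) c', (mem_algebraicClasses_map_iff_of_iso e.symm).2 hc', ?_⟩
    change complexBetti.map e.hom (2 * p) (complexBetti.map e.inv (2 * p) c') = c'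
    rw [← complexBetti.map_comp_apply', e.hom_inv_id, complexBetti.map_id]
    rfl
  · rintro _ ⟨c, hc, rfl⟩
    exact (mem_algebraicClasses_map_iff_of_iso e).2 hc

omit [IsFinite g.left] [Etale g.left] [ConnectedSpace (ComplexPoints S')] in
/-- **The fibres carry the SAME number of algebraic classes**: `dim N^p((𝒳 ×_S S')_{t'}) = dim N^p(X_{g(t')})`. [cite: GrothendieckTopology1969, §1] -/
theorem finrank_algebraicClasses_fiber_baseChange_eq (p : ℕ) (t' : ComplexPoints S') :
    Module.finrank ℂ ↥(algebraicClasses (fiberOver (familyPullback.snd f g) t') p) =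
      Module.finrank ℂ ↥(algebraicClasses (fiberOver f (AlgPoints.map g t')) p) := by
  rw [algebraicClasses_fiber_baseChange_eq g p t']
  exact (Submodule.equivMapOfInjective _ (complexBetti.map_injective_of_iso (fiberOverFamilyPullbackIso f g t') (2 * p)) _).finrank_eq.symm

/-! ## §2 Monotonicity: invariant classes, invariant algebraic classes and lifted classes can only grow upstairs -/

omit [IsFinite g.left] [Etale g.left] [ConnectedSpace (ComplexPoints S')] in
/-- `e^*(Im j^*_{g(t')}) ≤ Im j'^*_{t'}` (`e^* j^* W = j'^* G^* W`). [cite: DeligneHodgeII1971, Thm. 4.1.1] -/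
theorem map_range_fiberι_le_baseChange (k : ℕ) (t' : ComplexPoints S') :
    (LinearMap.range (complexBetti.map (fiberι f (AlgPoints.map g t')) k).hom).map
        (complexBetti.map (fiberOverFamilyPullbackIso f g t').hom k).hom ≤
      LinearMap.range (complexBetti.map (fiberι (familyPullback.snd f g) t') k).hom := by
  rintro _ ⟨_, ⟨W, rfl⟩, rfl⟩
  exact ⟨complexBetti.map (familyPullback.fst f g) k W, map_fiberι_comp_fst_eq g k t' W⟩

include hf in
/-- **`dim Im j^*_{g(t')} ≤ dim Im j'^*_{t'}`** — a finite étale base change can only ENLARGE the space of invariant classes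
(the monodromy group upstairs is a subgroup). FACT-FREE. [cite: DeligneHodgeII1971, Thm. 4.1.1 and Cor. 4.2.8] [cite: VoisinHodgeII2003, §4.3.1 Thm. 4.18] -/
theorem finrank_range_fiberι_le_baseChange (k : ℕ) (t' : ComplexPoints S') :
    Module.finrank ℂ ↥(LinearMap.range (complexBetti.map (fiberι f (AlgPoints.map g t')) k).hom) ≤
      Module.finrank ℂ ↥(LinearMap.range (complexBetti.map (fiberι (familyPullback.snd f g) t') k).hom) := by
  have hf' := isCompactAbelianPencil_familyPullback_snd hf g
  haveI : Module.Finite ℂ (complexBetti (fiberOver (familyPullback.snd f g) t') k) := finite_complexBetti (hf'.isSmoothProjective_fiberOver t') _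
  exact finrank_le_finrank_of_map_le_of_injective (complexBetti.map_injective_of_iso (fiberOverFamilyPullbackIso f g t') k)
    (map_range_fiberι_le_baseChange g k t')

omit [IsFinite g.left] [Etale g.left] [ConnectedSpace (ComplexPoints S')] in
/-- `e^*(N^p_inv(X_{g(t')})) ≤ N^p_inv((𝒳 ×_S S')_{t'})`. [cite: Abdulali1994FamiliesAV, (1.1) (p. 1122)] -/
theorem map_inf_range_le_baseChange (p : ℕ) (t' : ComplexPoints S') :
    (algebraicClasses (fiberOver f (AlgPoints.map g t')) p ⊓ LinearMap.range (complexBetti.map (fiberι f (AlgPoints.map g t')) (2 * p)).hom).map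
        (complexBetti.map (fiberOverFamilyPullbackIso f g t').hom (2 * p)).hom ≤
      algebraicClasses (fiberOver (familyPullback.snd f g) t') p ⊓
        LinearMap.range (complexBetti.map (fiberι (familyPullback.snd f g) t') (2 * p)).hom := by
  refine (Submodule.map_inf_le _).trans (inf_le_inf ?_ (map_range_fiberι_le_baseChange g (2 * p) t'))
  rw [algebraicClasses_fiber_baseChange_eq g p t']

include hf in
/-- **`dim N^p_inv(X_{g(t')}) ≤ dim N^p_inv((𝒳 ×_S S')_{t'})`** — invariant algebraic classes can only grow upstairs. FACT-FREE.
[cite: Abdulali1994FamiliesAV, (1.1) (p. 1122)] [cite: DeligneHodgeII1971, Cor. 4.2.8] -/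
theorem finrank_inf_range_le_baseChange (p : ℕ) (t' : ComplexPoints S') :
    Module.finrank ℂ ↥(algebraicClasses (fiberOver f (AlgPoints.map g t')) p ⊓
        LinearMap.range (complexBetti.map (fiberι f (AlgPoints.map g t')) (2 * p)).hom) ≤
      Module.finrank ℂ ↥(algebraicClasses (fiberOver (familyPullback.snd f g) t') p ⊓
        LinearMap.range (complexBetti.map (fiberι (familyPullback.snd f g) t') (2 * p)).hom) := by
  have hf' := isCompactAbelianPencil_familyPullback_snd hf g
  haveI : Module.Finite ℂ (complexBetti (fiberOver (familyPullback.snd f g) t') (2 * p)) :=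
    finite_complexBetti (hf'.isSmoothProjective_fiberOver t') _
  exact finrank_le_finrank_of_map_le_of_injective (complexBetti.map_injective_of_iso (fiberOverFamilyPullbackIso f g t') (2 * p))
    (map_inf_range_le_baseChange g p t')

include hf in
/-- `e^*(j^*_{g(t')} N^p(𝒳)) ≤ j'^*_{t'} N^p(𝒳 ×_S S')` (`G^*` preserves algebraic classes, `G` being finite: part XXXV-d
`map_fst_mem_algebraicClasses`). [cite: Fulton1998, §19.2 Cor. 19.2 (b) and §1.7] -/
theorem map_map_algebraicClasses_le_baseChange (p : ℕ) (t' : ComplexPoints S') :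
    ((algebraicClasses 𝒳 p).map (complexBetti.map (fiberι f (AlgPoints.map g t')) (2 * p)).hom).map
        (complexBetti.map (fiberOverFamilyPullbackIso f g t').hom (2 * p)).hom ≤
      (algebraicClasses (familyPullback f g) p).map (complexBetti.map (fiberι (familyPullback.snd f g) t') (2 * p)).hom := by
  rintro _ ⟨_, ⟨η, hη, rfl⟩, rfl⟩
  exact ⟨complexBetti.map (familyPullback.fst f g) (2 * p) η, map_fst_mem_algebraicClasses hf g hη, map_fiberι_comp_fst_eq g (2 * p) t' η⟩

include hf in
/-- **`r_p(f)(g(t')) ≤ r_p(f')(t')`** — lifted classes can only grow upstairs. FACT-FREE. [cite: Milne2020HodgeClassesAV, Prop. 1 (p. 7)]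
[cite: Fulton1998, §19.2 Cor. 19.2 (b)] -/
theorem finrank_map_algebraicClasses_le_baseChange (p : ℕ) (t' : ComplexPoints S') :
    Module.finrank ℂ ↥((algebraicClasses 𝒳 p).map (complexBetti.map (fiberι f (AlgPoints.map g t')) (2 * p)).hom) ≤
      Module.finrank ℂ ↥((algebraicClasses (familyPullback f g) p).map (complexBetti.map (fiberι (familyPullback.snd f g) t') (2 * p)).hom) := by
  have hf' := isCompactAbelianPencil_familyPullback_snd hf g
  haveI : Module.Finite ℂ (complexBetti (fiberOver (familyPullback.snd f g) t') (2 * p)) :=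
    finite_complexBetti (hf'.isSmoothProjective_fiberOver t') _
  exact finrank_le_finrank_of_map_le_of_injective (complexBetti.map_injective_of_iso (fiberOverFamilyPullbackIso f g t') (2 * p))
    (map_map_algebraicClasses_le_baseChange hf g p t')

/-! ## §3 Equalities when the cover creates no new invariant classes at `t'` -/

omit [IsFinite g.left] [Etale g.left] [ConnectedSpace (ComplexPoints S')] in
/-- Under `hinv` (part XXXV-d §3: every class upstairs agrees on the fibre over `t'` with some `G^* W`): **`Im j'^*_{t'} = e^* Im j^*_{g(t')}`**.
[cite: DeligneHodgeII1971, Thm. 4.1.1 and Cor. 4.2.8] -/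
theorem range_fiberι_baseChange_eq_of_forall_exists (k : ℕ) (t' : ComplexPoints S')
    (hinv : ∀ W' : complexBetti (familyPullback f g) k, ∃ W : complexBetti 𝒳 k,
      complexBetti.map (fiberι (familyPullback.snd f g) t') k W' =
        complexBetti.map (fiberι (familyPullback.snd f g) t') k (complexBetti.map (familyPullback.fst f g) k W)) :
    LinearMap.range (complexBetti.map (fiberι (familyPullback.snd f g) t') k).hom =
      (LinearMap.range (complexBetti.map (fiberι f (AlgPoints.map g t')) k).hom).map
        (complexBetti.map (fiberOverFamilyPullbackIso f g t').hom k).hom := by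
  refine le_antisymm ?_ (map_range_fiberι_le_baseChange g k t')
  rintro _ ⟨W', rfl⟩
  obtain ⟨W, hW⟩ := hinv W'
  refine ⟨complexBetti.map (fiberι f (AlgPoints.map g t')) k W, ⟨W, rfl⟩, ?_⟩
  change complexBetti.map (fiberOverFamilyPullbackIso f g t').hom k (complexBetti.map (fiberι f (AlgPoints.map g t')) k W) =
    complexBetti.map (fiberι (familyPullback.snd f g) t') k W'
  rw [← map_fiberι_comp_fst_eq g k t' W, ← hW]

omit [IsFinite g.left] [Etale g.left] [ConnectedSpace (ComplexPoints S')] in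
/-- Under `hinv`: **`dim Im j'^*_{t'} = dim Im j^*_{g(t')}`**. FACT-FREE. [cite: DeligneHodgeII1971, Cor. 4.2.8] -/
theorem finrank_range_fiberι_baseChange_eq_of_forall_exists (k : ℕ) (t' : ComplexPoints S')
    (hinv : ∀ W' : complexBetti (familyPullback f g) k, ∃ W : complexBetti 𝒳 k,
      complexBetti.map (fiberι (familyPullback.snd f g) t') k W' =
        complexBetti.map (fiberι (familyPullback.snd f g) t') k (complexBetti.map (familyPullback.fst f g) k W)) :
    Module.finrank ℂ ↥(LinearMap.range (complexBetti.map (fiberι (familyPullback.snd f g) t') k).hom) =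
      Module.finrank ℂ ↥(LinearMap.range (complexBetti.map (fiberι f (AlgPoints.map g t')) k).hom) := by
  rw [range_fiberι_baseChange_eq_of_forall_exists g k t' hinv]
  exact (Submodule.equivMapOfInjective _ (complexBetti.map_injective_of_iso (fiberOverFamilyPullbackIso f g t') k) _).finrank_eq.symm

omit [IsFinite g.left] [Etale g.left] [ConnectedSpace (ComplexPoints S')] in
/-- Under `hinv`: **`N^p_inv((𝒳 ×_S S')_{t'}) = e^* N^p_inv(X_{g(t')})`**. [cite: Abdulali1994FamiliesAV, (1.1) (p. 1122)] -/
theorem inf_range_baseChange_eq_of_forall_exists (p : ℕ) (t' : ComplexPoints S')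
    (hinv : ∀ W' : complexBetti (familyPullback f g) (2 * p), ∃ W : complexBetti 𝒳 (2 * p),
      complexBetti.map (fiberι (familyPullback.snd f g) t') (2 * p) W' =
        complexBetti.map (fiberι (familyPullback.snd f g) t') (2 * p) (complexBetti.map (familyPullback.fst f g) (2 * p) W)) :
    algebraicClasses (fiberOver (familyPullback.snd f g) t') p ⊓
        LinearMap.range (complexBetti.map (fiberι (familyPullback.snd f g) t') (2 * p)).hom =
      (algebraicClasses (fiberOver f (AlgPoints.map g t')) p ⊓
          LinearMap.range (complexBetti.map (fiberι f (AlgPoints.map g t')) (2 * p)).hom).map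
        (complexBetti.map (fiberOverFamilyPullbackIso f g t').hom (2 * p)).hom := by
  rw [algebraicClasses_fiber_baseChange_eq g p t', range_fiberι_baseChange_eq_of_forall_exists g (2 * p) t' hinv,
    ← Submodule.map_inf _ (complexBetti.map_injective_of_iso (fiberOverFamilyPullbackIso f g t') (2 * p))]

omit [IsFinite g.left] [Etale g.left] [ConnectedSpace (ComplexPoints S')] in
/-- Under `hinv`: **`dim N^p_inv((𝒳 ×_S S')_{t'}) = dim N^p_inv(X_{g(t')})`**. FACT-FREE. [cite: Abdulali1994FamiliesAV, (1.1) (p. 1122)] -/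
theorem finrank_inf_range_baseChange_eq_of_forall_exists (p : ℕ) (t' : ComplexPoints S')
    (hinv : ∀ W' : complexBetti (familyPullback f g) (2 * p), ∃ W : complexBetti 𝒳 (2 * p),
      complexBetti.map (fiberι (familyPullback.snd f g) t') (2 * p) W' =
        complexBetti.map (fiberι (familyPullback.snd f g) t') (2 * p) (complexBetti.map (familyPullback.fst f g) (2 * p) W)) :
    Module.finrank ℂ ↥(algebraicClasses (fiberOver (familyPullback.snd f g) t') p ⊓
        LinearMap.range (complexBetti.map (fiberι (familyPullback.snd f g) t') (2 * p)).hom) =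
      Module.finrank ℂ ↥(algebraicClasses (fiberOver f (AlgPoints.map g t')) p ⊓
        LinearMap.range (complexBetti.map (fiberι f (AlgPoints.map g t')) (2 * p)).hom) := by
  rw [inf_range_baseChange_eq_of_forall_exists g p t' hinv]
  exact (Submodule.equivMapOfInjective _ (complexBetti.map_injective_of_iso (fiberOverFamilyPullbackIso f g t') (2 * p)) _).finrank_eq.symm

include hf in
/-- Under `hinv`, in degrees `2p ≤ 2d`: **`j'^*_{t'} N^p(𝒳 ×_S S') = e^* j^*_{g(t')} N^p(𝒳)`** — for `η'` algebraic upstairs, `η' ≡ G^* W` on the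
fibre over `t'`, hence on EVERY fibre (part XVII upstairs); `G_* η'` is algebraic downstairs and `j^*_t G_* η' = j^*_t G_* G^* W − j^*_t G_*(G^* W − η')
= c · j^*_t W − 0` (degree trick, `c ≠ 0`; the ENGINE of part XXXV-c); so `j^*_t W = c⁻¹ j^*_t G_* η'` is a lifted class downstairs and
`j'^* η' = e^* j^*_t W`. FACT-FREE. [cite: Milne2020HodgeClassesAV, Prop. 1 (p. 7)] [cite: FultonYoungTableaux1997, Appendix B §B.1 (5)–(7)] -/
theorem map_algebraicClasses_baseChange_eq_of_forall_exists {p : ℕ} (hp : p ≤ d) (t' : ComplexPoints S')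
    (hinv : ∀ W' : complexBetti (familyPullback f g) (2 * p), ∃ W : complexBetti 𝒳 (2 * p),
      complexBetti.map (fiberι (familyPullback.snd f g) t') (2 * p) W' =
        complexBetti.map (fiberι (familyPullback.snd f g) t') (2 * p) (complexBetti.map (familyPullback.fst f g) (2 * p) W)) :
    (algebraicClasses (familyPullback f g) p).map (complexBetti.map (fiberι (familyPullback.snd f g) t') (2 * p)).hom =
      ((algebraicClasses 𝒳 p).map (complexBetti.map (fiberι f (AlgPoints.map g t')) (2 * p)).hom).map
        (complexBetti.map (fiberOverFamilyPullbackIso f g t').hom (2 * p)).hom := by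
  have hf' := isCompactAbelianPencil_familyPullback_snd hf g
  have hX := hf.isSmoothProjective_total
  have hX' := hf'.isSmoothProjective_total
  refine le_antisymm ?_ (map_map_algebraicClasses_le_baseChange hf g p t')
  rintro _ ⟨η', hη', rfl⟩
  obtain ⟨W, hW⟩ := hinv η'
  -- `κ' := η' - G^* W` dies on every fibre of `f'`
  have hκ' : ∀ s' : ComplexPoints S', complexBetti.map (fiberι (familyPullback.snd f g) s') (2 * p)
      (η' - complexBetti.map (familyPullback.fst f g) (2 * p) W) = 0 := by
    intro s'
    have hmem : η' - complexBetti.map (familyPullback.fst f g) (2 * p) W ∈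
        LinearMap.ker (complexBetti.map (fiberι (familyPullback.snd f g) s') (2 * p)).hom := by
      rw [ker_map_fiberι_eq hf' (2 * p) s' t', LinearMap.mem_ker]
      change complexBetti.map (fiberι (familyPullback.snd f g) t') (2 * p) (η' - complexBetti.map (familyPullback.fst f g) (2 * p) W) = 0
      rw [map_sub, hW, sub_self]
    exact hmem
  -- push down: `G_* η'` is algebraic, `j_t^* G_* η' = c • j_t^* W`
  haveI := surjective_familyPullback_fst_left hf g
  obtain ⟨c, hc0, hc⟩ := exists_complexGysin_map_eq_smul_of_surjective complexOrientationFamily hX' hX (familyPullback.fst f g)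
  have hGη : complexGysin complexOrientationFamily hX' hX (familyPullback.fst f g) rfl η' ∈ algebraicClasses 𝒳 p :=
    complexGysin_mem_algebraicClasses_of_mem_algebraicClasses complexOrientationFamily hX' hX (familyPullback.fst f g) _ hη'
  have hzero := map_fiberι_complexGysin_fst_eq_zero hf g hp hκ' (AlgPoints.map g t')
  rw [map_sub, map_sub, hc (2 * p) rfl W, map_smul, sub_eq_zero] at hzero
  -- `hzero : j_t^* (G_* η') = c • j_t^* W`
  have hjW : complexBetti.map (fiberι f (AlgPoints.map g t')) (2 * p) W ∈
      (algebraicClasses 𝒳 p).map (complexBetti.map (fiberι f (AlgPoints.map g t')) (2 * p)).hom := by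
    have h1 : complexBetti.map (fiberι f (AlgPoints.map g t')) (2 * p) W =
        c⁻¹ • complexBetti.map (fiberι f (AlgPoints.map g t')) (2 * p)
          (complexGysin complexOrientationFamily hX' hX (familyPullback.fst f g) rfl η') := by
      rw [hzero, smul_smul, inv_mul_cancel₀ hc0, one_smul]
    rw [h1]
    exact Submodule.smul_mem _ _ ⟨_, hGη, rfl⟩
  refine ⟨complexBetti.map (fiberι f (AlgPoints.map g t')) (2 * p) W, hjW, ?_⟩
  change complexBetti.map (fiberOverFamilyPullbackIso f g t').hom (2 * p) (complexBetti.map (fiberι f (AlgPoints.map g t')) (2 * p) W) =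
    complexBetti.map (fiberι (familyPullback.snd f g) t') (2 * p) η'
  rw [← map_fiberι_comp_fst_eq g (2 * p) t' W, ← hW]

include hf in
/-- Under `hinv`, `p ≤ d`: **`r_p(f')(t') = r_p(f)(g(t'))`**. FACT-FREE. [cite: Milne2020HodgeClassesAV, Prop. 1 (p. 7)] -/
theorem finrank_map_algebraicClasses_baseChange_eq_of_forall_exists {p : ℕ} (hp : p ≤ d) (t' : ComplexPoints S')
    (hinv : ∀ W' : complexBetti (familyPullback f g) (2 * p), ∃ W : complexBetti 𝒳 (2 * p),
      complexBetti.map (fiberι (familyPullback.snd f g) t') (2 * p) W' =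
        complexBetti.map (fiberι (familyPullback.snd f g) t') (2 * p) (complexBetti.map (familyPullback.fst f g) (2 * p) W)) :
    Module.finrank ℂ ↥((algebraicClasses (familyPullback f g) p).map (complexBetti.map (fiberι (familyPullback.snd f g) t') (2 * p)).hom) =
      Module.finrank ℂ ↥((algebraicClasses 𝒳 p).map (complexBetti.map (fiberι f (AlgPoints.map g t')) (2 * p)).hom) := by
  rw [map_algebraicClasses_baseChange_eq_of_forall_exists hf g hp t' hinv]
  exact (Submodule.equivMapOfInjective _ (complexBetti.map_injective_of_iso (fiberOverFamilyPullbackIso f g t') (2 * p)) _).finrank_eq.symm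

include hf in
/-- **Under `hinv` THE LIFT DEFECT IS INVARIANT: `δ_p(f', t') = δ_p(f, g(t'))`** (`p ≤ d`; written additively:
`dim N^p_inv(X'_{t'}) + r_p(f)(g t') = dim N^p_inv(X_{g t'}) + r_p(f')(t')`). FACT-FREE. [cite: Andre1996Motifs, §5.3 (p. 30)]
[cite: Milne2020HodgeClassesAV, Prop. 1 (p. 7)] -/
theorem liftDefect_baseChange_eq_of_forall_exists {p : ℕ} (hp : p ≤ d) (t' : ComplexPoints S')
    (hinv : ∀ W' : complexBetti (familyPullback f g) (2 * p), ∃ W : complexBetti 𝒳 (2 * p),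
      complexBetti.map (fiberι (familyPullback.snd f g) t') (2 * p) W' =
        complexBetti.map (fiberι (familyPullback.snd f g) t') (2 * p) (complexBetti.map (familyPullback.fst f g) (2 * p) W)) :
    Module.finrank ℂ ↥(algebraicClasses (fiberOver (familyPullback.snd f g) t') p ⊓
          LinearMap.range (complexBetti.map (fiberι (familyPullback.snd f g) t') (2 * p)).hom) +
        Module.finrank ℂ ↥((algebraicClasses 𝒳 p).map (complexBetti.map (fiberι f (AlgPoints.map g t')) (2 * p)).hom) =
      Module.finrank ℂ ↥(algebraicClasses (fiberOver f (AlgPoints.map g t')) p ⊓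
          LinearMap.range (complexBetti.map (fiberι f (AlgPoints.map g t')) (2 * p)).hom) +
        Module.finrank ℂ ↥((algebraicClasses (familyPullback f g) p).map
          (complexBetti.map (fiberι (familyPullback.snd f g) t') (2 * p)).hom) := by
  rw [finrank_inf_range_baseChange_eq_of_forall_exists g p t' hinv, finrank_map_algebraicClasses_baseChange_eq_of_forall_exists hf g hp t' hinv]

end BaseChange

end Summit.HodgeConjecture.HodgeConjecture.Ring2.AbelianAll

end
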